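import Summits.MatrixMultiplication.OmegaCensus.DominoZpZpCells
import Summits.MatrixMultiplication.OmegaCensus.DominoZ17Z17Cover
import HarnessLib

/-!
# No domino cube law with a part of size `3` over any `A ↠ ℤ_17 × ℤ_17`

ω-census `pub-omega`, family (b3), seat pub-omega-group gen 20.  Framing: lottery ticket; floor = certified bounds/negative
ranges.  VALUE: kernel theorems of the `ℤ_p²`-quotient column (`p = 17`) of the Dih-side mod-one classification — the census
cells `(1,3,32)@289` and every larger order, any `c₀` — as instances of the
generic `DominoZpZpCells.lean` (cover hypotheses from the kernel enumerations `exists_table_entry_17_d`, certified line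
tables `tableZ17d…`, half `η = 9`: `9 + 9 = 1` in `ZMod 17`); NOT progress on ω.

* `no_law_cube_1de_of_onto_z17z17` / `no_law_cube_1d_e_of_onto_z17z17` — parts `d ∈ {3}` in `T` / in `U`;
* the named cells `no_law_cube_13e_of_onto_z17z17` and `no_law_cube_1d3_of_onto_z17z17`.
-/

namespace Summit.MatrixMultiplication.OmegaCensus

open Finset ZpZpDomino Literature.Combinatorics.Additive

variable {A : Type} [AddCommGroup A] [DecidableEq A] [Fintype A] {G : Type} [Group G] [DecidableEq G]
  {ρ τ : A → G} {c₀ : A} {S T U : Finset G}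

/-- `9` is a half in `ZMod 17`. [folklore] -/
theorem half_zmod17 : (9 : ZMod 17) + 9 = 1 := by decide

/-- The cover hypothesis of `DominoZpZpCells` for `p = 17` and the part sizes with a kernel enumeration. [folklore] -/
theorem exists_cover_z17z17 {d : ℕ} (hd : d = 3) :
    ∃ Tb : List (List ℕ × List (ℕ × List ℕ)), (∀ e ∈ Tb, lineCert 17 (vecFn e.1) e.2 = true) ∧
      ∀ g : Fin (17 * 17) → ℕ, ∑ i, g i = d →
        ((1 ≤ g ⟨17, by decide⟩ ∧ 1 ≤ g ⟨1, by decide⟩) ∨ (1 ≤ g ⟨17, by decide⟩ ∧ ∀ i : Fin (17 * 17), i.val % 17 ≠ 0 → g i = 0) ∨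
          (∀ i : Fin (17 * 17), i.val ≠ 0 → g i = 0)) →
        ∃ j < 17 + 1, ∃ k : ℕ, k % 17 ≠ 0 ∧ ∃ e ∈ Tb, ∀ v < 17,
          e.1.getD (k * v % 17) 0 = ∑ i : Fin (17 * 17), pick v (pv 17 j i.val) (g i) := by
  haveI : Fact (Nat.Prime 17) := ⟨prime17⟩
  subst hd
  exact ⟨tableZ17d3c, tableZ17d3c_cert, exists_table_entry_17_3⟩

/-- **No `(1,1 | d,d | e,e)` law triple over `A ↠ ℤ_17 × ℤ_17` for `d ∈ {3}`**: dihedral-like `G` over `A` (any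
`c₀`), `φ : A →+ ZMod 17 × ZMod 17` onto, TPP triple with coset parts `|S₀| = |S₁| = 1`, `|T₀| = |T₁| = d`, `|U₀| = |U₁|` ⇒
`3|S||T||U| + 8 ≠ 8|A|`. [folklore] -/
theorem no_law_cube_1de_of_onto_z17z17 {d : ℕ} (hd : d = 3)
    (hρρ : ∀ a b, ρ a * ρ b = ρ (a + b)) (hρτ : ∀ a b, ρ a * τ b = τ (b - a))
    (hτρ : ∀ a b, τ a * ρ b = τ (a + b)) (hττ : ∀ a b, τ a * τ b = ρ (c₀ + b - a))
    (hρ : Function.Injective ρ) (hτ : Function.Injective τ) (hne : ∀ a b, ρ a ≠ τ b)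
    (hsurj : ∀ g, (∃ a, ρ a = g) ∨ (∃ a, τ a = g))
    (φ : A →+ ZMod 17 × ZMod 17) (hφ : Function.Surjective φ)
    (h : TripleProductProperty S T U)
    (hS₀ : (univ.filter fun a : A => ρ a ∈ S).card = 1) (hS₁ : (univ.filter fun a : A => τ a ∈ S).card = 1)
    (hT₀ : (univ.filter fun a : A => ρ a ∈ T).card = d) (hT₁ : (univ.filter fun a : A => τ a ∈ T).card = d)
    (hU : (univ.filter fun a : A => ρ a ∈ U).card = (univ.filter fun a : A => τ a ∈ U).card)
    (hV : 3 * (S.card * T.card * U.card) + 8 = 8 * Fintype.card A) : False := by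
  haveI : Fact (Nat.Prime 17) := ⟨prime17⟩
  obtain ⟨Tb, hTb, hcov⟩ := exists_cover_z17z17 hd
  exact no_law_cube_1de_of_onto_zpzp_of_cover (9 : ZMod 17) half_zmod17 Tb hTb ⟨17, by decide⟩ ⟨1, by decide⟩ rfl rfl hcov
    hρρ hρτ hτρ hττ hρ hτ hne hsurj φ hφ h hS₀ hS₁ hT₀ hT₁ hU hV

/-- **No `(1,1 | d,d | e,e)` law triple over `A ↠ ℤ_17 × ℤ_17` for `e ∈ {3}`** (the small parts in `U`).
[folklore] -/
theorem no_law_cube_1d_e_of_onto_z17z17 {e : ℕ} (he : e = 3)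
    (hρρ : ∀ a b, ρ a * ρ b = ρ (a + b)) (hρτ : ∀ a b, ρ a * τ b = τ (b - a))
    (hτρ : ∀ a b, τ a * ρ b = τ (a + b)) (hττ : ∀ a b, τ a * τ b = ρ (c₀ + b - a))
    (hρ : Function.Injective ρ) (hτ : Function.Injective τ) (hne : ∀ a b, ρ a ≠ τ b)
    (hsurj : ∀ g, (∃ a, ρ a = g) ∨ (∃ a, τ a = g))
    (φ : A →+ ZMod 17 × ZMod 17) (hφ : Function.Surjective φ)
    (h : TripleProductProperty S T U)
    (hS₀ : (univ.filter fun a : A => ρ a ∈ S).card = 1) (hS₁ : (univ.filter fun a : A => τ a ∈ S).card = 1)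
    (hT : (univ.filter fun a : A => ρ a ∈ T).card = (univ.filter fun a : A => τ a ∈ T).card)
    (hU₀ : (univ.filter fun a : A => ρ a ∈ U).card = e) (hU₁ : (univ.filter fun a : A => τ a ∈ U).card = e)
    (hV : 3 * (S.card * T.card * U.card) + 8 = 8 * Fintype.card A) : False := by
  haveI : Fact (Nat.Prime 17) := ⟨prime17⟩
  obtain ⟨Tb, hTb, hcov⟩ := exists_cover_z17z17 he
  exact no_law_cube_1d_e_of_onto_zpzp_of_cover (9 : ZMod 17) half_zmod17 Tb hTb ⟨17, by decide⟩ ⟨1, by decide⟩ rfl rfl hcov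
    hρρ hρτ hτρ hττ hρ hτ hne hsurj φ hφ h hS₀ hS₁ hT hU₀ hU₁ hV

/-- **Cell form `(1, 3, e)` over `A ↠ ℤ_17²**: no TPP triple with parts `(1,1 | 3,3 | e,e)` attains the mod-one law.
[folklore] -/
theorem no_law_cube_13e_of_onto_z17z17
    (hρρ : ∀ a b, ρ a * ρ b = ρ (a + b)) (hρτ : ∀ a b, ρ a * τ b = τ (b - a))
    (hτρ : ∀ a b, τ a * ρ b = τ (a + b)) (hττ : ∀ a b, τ a * τ b = ρ (c₀ + b - a))
    (hρ : Function.Injective ρ) (hτ : Function.Injective τ) (hne : ∀ a b, ρ a ≠ τ b)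
    (hsurj : ∀ g, (∃ a, ρ a = g) ∨ (∃ a, τ a = g))
    (φ : A →+ ZMod 17 × ZMod 17) (hφ : Function.Surjective φ)
    (h : TripleProductProperty S T U)
    (hS₀ : (univ.filter fun a : A => ρ a ∈ S).card = 1) (hS₁ : (univ.filter fun a : A => τ a ∈ S).card = 1)
    (hT₀ : (univ.filter fun a : A => ρ a ∈ T).card = 3) (hT₁ : (univ.filter fun a : A => τ a ∈ T).card = 3)
    (hU : (univ.filter fun a : A => ρ a ∈ U).card = (univ.filter fun a : A => τ a ∈ U).card)
    (hV : 3 * (S.card * T.card * U.card) + 8 = 8 * Fintype.card A) : False :=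
  no_law_cube_1de_of_onto_z17z17 (rfl) hρρ hρτ hτρ hττ hρ hτ hne hsurj φ hφ h hS₀ hS₁ hT₀ hT₁ hU hV

/-- **Cell form `(1, d, 3)`** over `A ↠ ℤ_17²` (the parts `3` in `U`). [folklore] -/
theorem no_law_cube_1d3_of_onto_z17z17
    (hρρ : ∀ a b, ρ a * ρ b = ρ (a + b)) (hρτ : ∀ a b, ρ a * τ b = τ (b - a))
    (hτρ : ∀ a b, τ a * ρ b = τ (a + b)) (hττ : ∀ a b, τ a * τ b = ρ (c₀ + b - a))
    (hρ : Function.Injective ρ) (hτ : Function.Injective τ) (hne : ∀ a b, ρ a ≠ τ b)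
    (hsurj : ∀ g, (∃ a, ρ a = g) ∨ (∃ a, τ a = g))
    (φ : A →+ ZMod 17 × ZMod 17) (hφ : Function.Surjective φ)
    (h : TripleProductProperty S T U)
    (hS₀ : (univ.filter fun a : A => ρ a ∈ S).card = 1) (hS₁ : (univ.filter fun a : A => τ a ∈ S).card = 1)
    (hT : (univ.filter fun a : A => ρ a ∈ T).card = (univ.filter fun a : A => τ a ∈ T).card)
    (hU₀ : (univ.filter fun a : A => ρ a ∈ U).card = 3) (hU₁ : (univ.filter fun a : A => τ a ∈ U).card = 3)
    (hV : 3 * (S.card * T.card * U.card) + 8 = 8 * Fintype.card A) : False :=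
  no_law_cube_1d_e_of_onto_z17z17 (rfl) hρρ hρτ hτρ hττ hρ hτ hne hsurj φ hφ h hS₀ hS₁ hT hU₀ hU₁ hV

end Summit.MatrixMultiplication.OmegaCensus
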